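import Summits.BirchSwinnertonDyer.Rank1Residual.X11b.BDPRouteLocalKernelSnake
import Summits.BirchSwinnertonDyer.Rank1Residual.X11b.BDPRouteLocalNonsingularBridge
import Literature.NumberTheory.EllipticCurves.IwasawaSelmerControlAwayFromPProofs
import HarnessLib

/-!
# Class X11b, route p2: the local PURITY count `#E(K_v)[p^∞] = #E₀(K_v)[p^∞] · c_v^{(p)}` at a
# finite place `v ∤ p` (cell `b2b-bsdres`, sub-cell `multr1-p2`, gen 20)

HONEST FRAMING (verbatim, cell `b2b-bsdres`): the goal of the cell is to DELETE the
COMBINATION-SHAPED residual classes for ALL analytic-rank `≤ 1` curves over `ℚ` — "full BSD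
formula for every rank `≤ 1` curve in class `C`" assembled STRICTLY from published theorems — so
that the rank-`≤ 1` remainder becomes exactly the CONSTRUCTION-SHAPED classes, which are TYPED
(missing-input Props), NOT attempted; this is not "finishing BSD". Research route `p2` for class
X11b; no claim beyond the stated class; nothing booked; X11b stays CONSTRUCTION-SHAPED. Theorems
only; no definition, no named fact, no `sorry`.

## Why this file

Greenberg's Lemma 3.3 EXACT at a bad place `v ∤ p` (LNM 1716, proof of Thm. 4.1, p. 74: "`ker r_v`
has order `c_v^{(p)}`"; route R1's atom (P11) `LocalKernelOrderAt`) needs, besides the cohomological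
transport (`B_v/(γ_v − 1)B_v`, sibling `ProcyclicDescentKernel`) and the snake identity
(`BDPRouteLocalKernelSnake`), ONE arithmetic input: on the minimal model `X = M ⊗ K_v` at `v`,

  `#X(K_v)[p^∞] = #X₀(K_v)[p^∞] · p ^ ord_p c_v`,  `c_v = [X(K_v) : X₀(K_v)]` (Kodaira–Néron),

for EVERY reduction type. It follows from three properties of the kernel of reduction
`E₁(K_v) ≤ X₀(K_v)` (Silverman *AEC* VII.2.1/2.2, VII.3.1, IV.2.3, Cor. VII.6.2), all theorems of
the tree over `K̄_v` (file `IwasawaSelmerControlAwayFromPProofs`, Greenberg's Lemma 3.3 at layer 0),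
descended here to `K_v`-rational points:

* `kernelOfReduction_nsmul_divisible` — `E₁(K_v)` is `p`-divisible inside `E₁(K_v)` for `p` a unit
  of `𝓞_v` (successive approximation on the complete `K_v`, `exists_pow_nsmul_eq_of_mem_kernel`, and
  Galois descent of the quotient, `exists_point_map_eq_of_forall_map_eq`);
* `kernelOfReduction_torsionFree` — `E₁(K_v)` has no `p`-torsion (`eq_zero_of_nsmul_eq_zero_of_mem_kernel`,
  *AEC* VII.3.1);
* `finiteIndex_kernelOfReduction_localMinimalIntegralModel` — `[X(K_v) : E₁(K_v)] < ∞`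
  (`index_ne_zero_of_forall_some_mem`, *AEC* Cor. VII.6.2 / Ex. 7.6 over `𝓞_v`);

and the pure algebra `natCard_primaryComponent_eq_mul_pow_of_divisible_le` (gen 20). Main result:
**`natCard_primaryComponent_point_eq_mul_pow_localTamagawaNumber`**.

CONDITIONAL use only (input of the (P11)/control-`=` programme, `BDPRouteLocalKernelExact`); nothing
booked; reach and labels unchanged.

References: [SilvermanAEC2009] VII.2.1–2.2, VII.3.1, IV.2.3, Thm. VII.6.1, Cor. VII.6.2, Ex. 7.6;
[GreenbergLNM1716] §3 Lemma 3.3 (p. 87), §4 proof of Thm. 4.1 (p. 74).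
-/

noncomputable section

open scoped Classical NNReal

open NumberField IsDedekindDomain Field IsDedekindDomain.HeightOneSpectrum WeierstrassCurve
open Literature.NumberTheory.EllipticCurves Literature.NumberTheory.EllipticCurves.FormalGroupChart
open Literature.NumberTheory.GaloisRepresentations

universe u

namespace Summit.BirchSwinnertonDyer.Rank1Residual.X11b.LocalPurity

variable {K : Type u} [Field K] [NumberField K] (W : WeierstrassCurve K) (v : HeightOneSpectrum (𝓞 K))

/-! ## Transport along an equality of equations (identity on coordinates) -/

omit [NumberField K] in
/-- `congrEquiv h.symm ∘ congrEquiv h = id`. [folklore] -/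
theorem congrEquiv_symm_apply_congrEquiv {F : Type u} [Field F] {W₁ W₂ : WeierstrassCurve F}
    (h : W₁ = W₂) (P : W₁.toAffine.Point) :
    Affine.Point.congrEquiv h.symm (Affine.Point.congrEquiv h P) = P := by
  subst h; rfl

/-! ## The comparison map `ψ : X(K_v) → X(K̄_v)` and the kernel of reduction -/

/-- `(M ⊗ K_v) ⊗_{K_v} K_v = M ⊗ K_v` for the minimal `𝓞_v`-model `M` (so that Mathlib's
`Affine.Point.map (Algebra.ofId K_v K̄_v)` is defined on the `K_v`-points of `M`). [folklore] -/
theorem baseChange_self_eq :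
    ((W.localMinimalIntegralModel v).map (algebraMap (v.adicCompletionIntegers K)
        (v.adicCompletion K))).baseChange (v.adicCompletion K) =
      (W.localMinimalIntegralModel v).baseChange (v.adicCompletion K) := by
  change ((W.localMinimalIntegralModel v).map _).map (algebraMap (v.adicCompletion K)
    (v.adicCompletion K)) = (W.localMinimalIntegralModel v).map _
  rw [Algebra.algebraMap_self, WeierstrassCurve.map_id]

/-- A `K_v`-rational point, pushed to `X(K̄_v)`, is fixed by `Γ_{K_v}` (Mathlib `map_baseChange`).
[folklore] -/
theorem map_galois_baseChange_point (σ : absoluteGaloisGroup (v.adicCompletion K))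
    (R : (((W.localMinimalIntegralModel v).map (algebraMap (v.adicCompletionIntegers K)
        (v.adicCompletion K))).baseChange (v.adicCompletion K)).toAffine.Point) :
    Affine.Point.map ((absoluteGaloisGroup.toAlgEquiv _ σ :
        AlgebraicClosure (v.adicCompletion K) ≃ₐ[v.adicCompletion K]
          AlgebraicClosure (v.adicCompletion K)) :
        AlgebraicClosure (v.adicCompletion K) →ₐ[v.adicCompletion K]
          AlgebraicClosure (v.adicCompletion K))
      (Affine.Point.map (W' := (W.localMinimalIntegralModel v).map (algebraMap
          (v.adicCompletionIntegers K) (v.adicCompletion K)))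
        (Algebra.ofId (v.adicCompletion K) (AlgebraicClosure (v.adicCompletion K))) R) =
      Affine.Point.map (W' := (W.localMinimalIntegralModel v).map (algebraMap
          (v.adicCompletionIntegers K) (v.adicCompletion K)))
        (Algebra.ofId (v.adicCompletion K) (AlgebraicClosure (v.adicCompletion K))) R :=
  Affine.Point.map_baseChange _ R

variable {W v} in
/-- A `K_v`-rational point of `X` reduces to `O` (lies in `E₁(K_v)`) iff its image in `X(K̄_v)` lies
in the kernel of reduction for the spectral valuation `|·|_v` (`|x₀|_v > 1 ↔ x₀ ∉ 𝓞_v`).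
[cite: SilvermanAEC2009, VII.2 Prop. 2.1 (`E₁`)] -/
theorem reducesToZero_iff_map_mem_kernel
    {w : Valuation (AlgebraicClosure (v.adicCompletion K)) ℝ≥0}
    (hw : ∀ x, (w x : ℝ) =
      spectralNorm (v.adicCompletion K) (AlgebraicClosure (v.adicCompletion K)) x)
    [(((W.localMinimalIntegralModel v).map (algebraMap (v.adicCompletionIntegers K)
        (v.adicCompletion K))).baseChange (AlgebraicClosure (v.adicCompletion K))).IsIntegral
      w.integer]
    (R : (((W.localMinimalIntegralModel v).map (algebraMap (v.adicCompletionIntegers K)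
        (v.adicCompletion K))).baseChange (v.adicCompletion K)).toAffine.Point) :
    (W.localMinimalIntegralModel v).ReducesToZero (Affine.Point.congrEquiv (baseChange_self_eq W v) R) ↔
      Affine.Point.map (W' := (W.localMinimalIntegralModel v).map (algebraMap
          (v.adicCompletionIntegers K) (v.adicCompletion K)))
        (Algebra.ofId (v.adicCompletion K) (AlgebraicClosure (v.adicCompletion K))) R ∈
        kernel w (((W.localMinimalIntegralModel v).map (algebraMap (v.adicCompletionIntegers K)
          (v.adicCompletion K))).baseChange (AlgebraicClosure (v.adicCompletion K))) := by
  obtain rfl | ⟨x₀, y₀, h₀, rfl⟩ : R = 0 ∨ ∃ x y h, R = .some x y h := by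
    rcases R with _ | ⟨x, y, h⟩
    exacts [Or.inl rfl, Or.inr ⟨x, y, h, rfl⟩]
  · rw [map_zero, map_zero]
    exact iff_of_true reducesToZero_zero fun he ↦ (Affine.Point.some_ne_zero _ he.symm).elim
  · rw [Affine.Point.congrEquiv_some, Affine.Point.map_some, reducesToZero_some_iff]
    constructor
    · intro hx x y h he
      simp only [Affine.Point.some.injEq] at he
      obtain ⟨rfl, -⟩ := he
      rw [← not_le, show ((Algebra.ofId (v.adicCompletion K) (AlgebraicClosure (v.adicCompletion K)))
        x₀ = algebraMap _ _ x₀) from rfl, spectralValuation_algebraMap_le_one_iff hw]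
      exact fun hx' ↦ hx ⟨⟨x₀, hx'⟩, rfl⟩
    · intro hmem
      have h1 : 1 < w (algebraMap (v.adicCompletion K) (AlgebraicClosure (v.adicCompletion K)) x₀) :=
        hmem rfl
      rintro ⟨a, rfl⟩
      exact (not_le.mpr h1) ((spectralValuation_algebraMap_le_one_iff hw _).mpr a.2)

/-! ## `E₁(K_v)`: no `p`-torsion, `p`-divisible, finite index -/

/-- **`E₁(K_v)` has no `p`-torsion** for `p` a unit of `𝓞_v` (Silverman *AEC* VII.3.1, the tree's
`eq_zero_of_nsmul_eq_zero_of_mem_kernel` over `K̄_v`, pulled back along `X(K_v) ↪ X(K̄_v)`).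
[cite: SilvermanAEC2009, Prop. VII.3.1] -/
theorem kernelOfReduction_torsionFree [W.IsElliptic] {p : ℕ}
    (hp : IsUnit ((p : ℕ) : v.adicCompletionIntegers K)) :
    ∀ P ∈ (W.localMinimalIntegralModel v).kernelOfReduction
        (integers_valuationRing_valuation (v.adicCompletionIntegers K) (v.adicCompletion K)),
      p • P = 0 → P = 0 := by
  intro P hP h0
  obtain ⟨w, hw⟩ := v.exists_spectralValuation
  haveI := WeierstrassCurve.isIntegral_spectralValuation_baseChange hw (W.localMinimalIntegralModel v)
  set R := Affine.Point.congrEquiv (baseChange_self_eq W v).symm P with hR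
  have hPR : P = Affine.Point.congrEquiv (baseChange_self_eq W v) R := by
    rw [hR]
    exact (congrEquiv_symm_apply_congrEquiv (baseChange_self_eq W v).symm P).symm
  have hmem : Affine.Point.map (W' := (W.localMinimalIntegralModel v).map (algebraMap
        (v.adicCompletionIntegers K) (v.adicCompletion K)))
      (Algebra.ofId (v.adicCompletion K) (AlgebraicClosure (v.adicCompletion K))) R ∈
      kernel w (((W.localMinimalIntegralModel v).map (algebraMap (v.adicCompletionIntegers K)
        (v.adicCompletion K))).baseChange (AlgebraicClosure (v.adicCompletion K))) :=
    (reducesToZero_iff_map_mem_kernel hw R).mp (by rw [← hPR]; exact hP)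
  have h0' : p • Affine.Point.map (W' := (W.localMinimalIntegralModel v).map (algebraMap
        (v.adicCompletionIntegers K) (v.adicCompletion K)))
      (Algebra.ofId (v.adicCompletion K) (AlgebraicClosure (v.adicCompletion K))) R = 0 := by
    rw [← map_nsmul, hR, ← map_nsmul, h0, map_zero, map_zero]
  have hR0 := W.eq_zero_of_nsmul_eq_zero_of_mem_kernel hw hp hmem h0'
  have hinj := Affine.Point.map_injective (W' := (W.localMinimalIntegralModel v).map (algebraMap
      (v.adicCompletionIntegers K) (v.adicCompletion K)))
    (Algebra.ofId (v.adicCompletion K) (AlgebraicClosure (v.adicCompletion K)))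
  have hR0' : R = 0 := hinj (by rw [hR0, map_zero])
  rw [hPR, hR0', map_zero]

/-- **`E₁(K_v)` is `p`-divisible inside `E₁(K_v)`** for `p` a unit of `𝓞_v`: for `P ∈ E₁(K_v)` there
is `Q ∈ E₁(K_v)` with `p • Q = P` (Silverman *AEC* IV.2.3/VII.2.2: `[p]` is an automorphism of
`Ê(𝓜) ≅ E₁(K_v)`; the tree's `exists_pow_nsmul_eq_of_mem_kernel` produces `Q ∈ E₁(K̄_v)` fixed by
every `σ ∈ Γ_{K_v}` fixing `P`, and Galois descent `exists_point_map_eq_of_forall_map_eq` brings it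
down to `K_v`). [cite: SilvermanAEC2009, Prop. IV.2.3 and Prop. VII.2.2] -/
theorem kernelOfReduction_nsmul_divisible [W.IsElliptic] {p : ℕ}
    (hp : IsUnit ((p : ℕ) : v.adicCompletionIntegers K)) :
    ∀ P ∈ (W.localMinimalIntegralModel v).kernelOfReduction
        (integers_valuationRing_valuation (v.adicCompletionIntegers K) (v.adicCompletion K)),
      ∃ Q ∈ (W.localMinimalIntegralModel v).kernelOfReduction
        (integers_valuationRing_valuation (v.adicCompletionIntegers K) (v.adicCompletion K)),
        p • Q = P := by
  intro P hP
  obtain ⟨w, hw⟩ := v.exists_spectralValuation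
  obtain ⟨𝔐, h𝔐⟩ := v.localPrimesAbove_nonempty
  haveI := WeierstrassCurve.isIntegral_spectralValuation_baseChange hw (W.localMinimalIntegralModel v)
  let X := (W.localMinimalIntegralModel v).map (algebraMap (v.adicCompletionIntegers K)
    (v.adicCompletion K))
  set R := Affine.Point.congrEquiv (baseChange_self_eq W v).symm P with hR
  have hPR : P = Affine.Point.congrEquiv (baseChange_self_eq W v) R := by
    rw [hR]
    exact (congrEquiv_symm_apply_congrEquiv (baseChange_self_eq W v).symm P).symm
  -- `ψ P ∈ E₁(K̄_v)`, fixed by `Γ_{K_v}`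
  have hPK : Affine.Point.map (W' := X)
      (Algebra.ofId (v.adicCompletion K) (AlgebraicClosure (v.adicCompletion K))) R ∈
      kernel w (X.baseChange (AlgebraicClosure (v.adicCompletion K))) :=
    (reducesToZero_iff_map_mem_kernel hw R).mp (by rw [← hPR]; exact hP)
  have hPI : ∀ τ ∈ 𝔐.inertia (absoluteGaloisGroup (v.adicCompletion K)),
      Affine.Point.map ((absoluteGaloisGroup.toAlgEquiv _ τ :
          AlgebraicClosure (v.adicCompletion K) ≃ₐ[v.adicCompletion K]
            AlgebraicClosure (v.adicCompletion K)) :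
          AlgebraicClosure (v.adicCompletion K) →ₐ[v.adicCompletion K]
            AlgebraicClosure (v.adicCompletion K))
        (Affine.Point.map (W' := X)
          (Algebra.ofId (v.adicCompletion K) (AlgebraicClosure (v.adicCompletion K))) R) =
        Affine.Point.map (W' := X)
          (Algebra.ofId (v.adicCompletion K) (AlgebraicClosure (v.adicCompletion K))) R :=
    fun τ _ ↦ map_galois_baseChange_point W v τ R
  -- divide by `p` in `E₁(K̄_v)`, equivariantly
  obtain ⟨Q, hQK, hQfix, hQ⟩ := W.exists_pow_nsmul_eq_of_mem_kernel hw h𝔐 hp 1 hPK hPI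
  have hQfix' : ∀ σ : absoluteGaloisGroup (v.adicCompletion K),
      Affine.Point.map ((absoluteGaloisGroup.toAlgEquiv _ σ :
          AlgebraicClosure (v.adicCompletion K) ≃ₐ[v.adicCompletion K]
            AlgebraicClosure (v.adicCompletion K)) :
          AlgebraicClosure (v.adicCompletion K) →ₐ[v.adicCompletion K]
            AlgebraicClosure (v.adicCompletion K)) Q = Q :=
    fun σ ↦ hQfix σ (map_galois_baseChange_point W v σ R)
  -- Galois descent of `Q`
  obtain ⟨R', hR'⟩ := AcSelmer.exists_point_map_eq_of_forall_map_eq X hQfix'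
  refine ⟨Affine.Point.congrEquiv (baseChange_self_eq W v) R', ?_, ?_⟩
  · exact (reducesToZero_iff_map_mem_kernel hw R').mpr (by rw [hR']; exact hQK)
  · have hinj := Affine.Point.map_injective (W' := X)
      (Algebra.ofId (v.adicCompletion K) (AlgebraicClosure (v.adicCompletion K)))
    have hpR : p • R' = R := hinj (by rw [map_nsmul, hR', ← hQ, pow_one])
    rw [hPR, ← map_nsmul, hpR]

/-- **`[X(K_v) : E₁(K_v)] < ∞`** on the minimal model (Silverman *AEC* Cor. VII.6.2 / Ex. 7.6 over
the complete discrete valuation ring `𝓞_v` with finite residue field; the tree's uniform form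
`index_ne_zero_of_forall_some_mem`). [cite: SilvermanAEC2009, Cor. VII.6.2 and Exercise 7.6] -/
theorem finiteIndex_kernelOfReduction_localMinimalIntegralModel [W.IsElliptic] :
    ((W.localMinimalIntegralModel v).kernelOfReduction
        (integers_valuationRing_valuation (v.adicCompletionIntegers K) (v.adicCompletion K))).FiniteIndex := by
  haveI : Finite (IsLocalRing.ResidueField (v.adicCompletionIntegers K)) :=
    finite_residueField_adicCompletionIntegers K v
  haveI := W.isElliptic_map_localMinimalIntegralModel (v := v)
  have hΔ : (W.localMinimalIntegralModel v).Δ ≠ 0 := by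
    intro h0
    apply (WeierstrassCurve.Δ' ((W.localMinimalIntegralModel v).map (algebraMap
      (v.adicCompletionIntegers K) (v.adicCompletion K)))).ne_zero
    change ((W.localMinimalIntegralModel v).map (algebraMap (v.adicCompletionIntegers K)
      (v.adicCompletion K))).Δ = 0
    rw [map_Δ, h0, map_zero]
  exact ⟨index_ne_zero_of_forall_some_mem (W.localMinimalIntegralModel v) hΔ _
    fun x y h hx ↦ (reducesToZero_some_iff h).mpr hx⟩

/-! ## The purity count -/

/-- **`#X(K_v)[p^∞] = #X₀(K_v)[p^∞] · p ^ ord_p c_v` at a finite place `v ∤ p`, for every reduction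
type.** On the minimal `𝓞_v`-model `M` of `E/K` at `v` (`X = M ⊗ K_v`, `X₀(K_v)` the subgroup of
points with non-singular reduction, `c_v(E/K) = [X(K_v) : X₀(K_v)]` by Kodaira–Néron /
`localTamagawaNumber_eq_index_nonsingularReductionSubgroup`), the `p`-power torsion of `X(K_v)` is
finite and its order is that of the `p`-power torsion of `X₀(K_v)` times the `p`-part of the local
Tamagawa number: the kernel of reduction `E₁(K_v) ≤ X₀(K_v)` is `p`-divisible, `p`-torsion-free and
of finite index, so `X(K_v)[p^∞] ≅ (X(K_v)/E₁)[p^∞]`, `X₀(K_v)[p^∞] ≅ (X₀(K_v)/E₁)[p^∞]` and the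
orders of `p`-primary parts of finite abelian groups are multiplicative along
`X₀/E₁ ≤ X/E₁`. This is the arithmetic input "`#ker r_v = c_v^{(p)}`" uses at a bad `v ∤ p`
(Greenberg LNM 1716, p. 74), in the form needed by `BDPRouteLocalKernelExact`.
[cite: GreenbergLNM1716, §4 proof of Thm. 4.1 (p. 74) and §3 Lemma 3.3 (p. 87)]
[cite: SilvermanAEC2009, Thm. VII.6.1, Cor. VII.6.2, Prop. VII.2.1, VII.3.1, IV.2.3] -/
theorem natCard_primaryComponent_point_eq_mul_pow_localTamagawaNumber [W.IsElliptic] {p : ℕ}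
    [Fact p.Prime] (hpv : (p : 𝓞 K) ∉ v.asIdeal) :
    Finite (AddCommGroup.primaryComponent
        ((W.localMinimalIntegralModel v).baseChange (v.adicCompletion K)).toAffine.Point p) ∧
      Nat.card (AddCommGroup.primaryComponent
          ((W.localMinimalIntegralModel v).baseChange (v.adicCompletion K)).toAffine.Point p) =
        Nat.card (AddCommGroup.primaryComponent
            ↥((W.localMinimalIntegralModel v).nonsingularReductionSubgroup
              (integers_valuationRing_valuation (v.adicCompletionIntegers K) (v.adicCompletion K))) p) *
          p ^ padicValNat p
            ((W.baseChange (v.adicCompletion K)).localTamagawaNumber (v.adicCompletionIntegers K)) := by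
  have hp : IsUnit ((p : ℕ) : v.adicCompletionIntegers K) := by
    have h := isUnit_algebraMap_adicCompletionIntegers K v hpv
    rwa [map_natCast] at h
  haveI := finiteIndex_kernelOfReduction_localMinimalIntegralModel W v
  rw [AcSelmer.localTamagawaNumber_eq_index_nonsingularReductionSubgroup]
  exact TamagawaCoinvariants.natCard_primaryComponent_eq_mul_pow_of_divisible_le p _ _
    (kernelOfReduction_le_nonsingularReductionSubgroup _)
    (kernelOfReduction_nsmul_divisible W v hp) (kernelOfReduction_torsionFree W v hp)

end Summit.BirchSwinnertonDyer.Rank1Residual.X11b.LocalPurity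

end
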